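import Summits.AtomisticToContinuum.Crystallization.Theorems.FreeSplittingCertificatesRadiusLadder

/-!
# `FiniteRangeSplitting` (stmt-AtomisticToContinuum-12559): explicit weak duality for the recurrent-pattern LP

Companion of `FreeSplittingCertificatesRadiusLadder` (block-2b unit `b2b-freesplit-A`, gen 5).
VALUE = the soundness theorem that makes ANY exact dual (Farkas) vector of the lj-lp / R = 2 recurrent-pattern
LP a Lean refutation of a rung — NOT summit progress; nothing here closes an item.

The LP behind every certificate of the lane (`LP_FORMAT.md`) has one variable per translation class of realised
bond keys `k = (v, T)` (bond vector, joint `R`-pattern) and one row per site.  Its dual value for a weight vector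
`y ≥ 0` on rows is `U(y) = Σ_r y_r const_r + Σ_k max(0, (yᵀA)_k)`; this file proves the corresponding statement
directly over the crux vocabulary (`IsRule`, `siteE`, `Feasible`, `RungAt`), with no LP in between:

* `Key`, `Key.conj` (`(v,T) ↦ (-v, T - v)`, the key of the reversed bond; complementarity reads
  `Φ k + Φ k.conj = 1`) and `Key.inv` (`(v,T) ↦ (-v, -T)`); both are involutions.
* a WEIGHTED ZOO: finitely many rows `r : ι`, each a configuration `x r`, a site `i r` and a weight `y r`;
  `bkey` = the key of the bond `(i r, j)`; `load … k` = `A_k := Σ_{bonds with key k} y_r · V(r_ij)`.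
* `weighted_siteE_eq` : `Σ_r y_r · siteE R Φ (x r) (i r) = Σ_{k ∈ S} Φ(k) · A_k` for every key set `S` containing
  the bond keys (regrouping by classes);
* `sum_le_farkas` : for every RULE `Φ`, `Σ_{k∈S} Φ(k) A_k ≤ ½ Σ_{k∈S} max(A_k, A_{conj k})` (`S` closed under
  `conj`) — the class-by-class form `Σ_{V<0} V·min(y⁺,y⁻) + Σ_{V>0} V·max(y⁺,y⁻)` of RESULTS-R2 §6 P2/P6;
* `sum_le_farkas_inv` : for an inversion-symmetric rule (`Φ k.inv = Φ k`, free by `feasible_invAvg`),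
  `Σ Φ(k) A_k ≤ ¼ Σ_{k∈S} max(A_k + A_{inv k}, A_{conj k} + A_{inv (conj k)})` (`S` closed under both);
* WEAK DUALITY `threshold_le_farkas` / `eInf_le_farkas` / `eInf_le_farkas_inv` :
  `RungAt δ R → (Σ_r y_r) · e_∞ ≤ U(y)` on every weighted zoo of `δ`-separated configurations, and the
  certificate form `not_rungAt_of_farkas(_inv)` : `U(y) < (Σ y) · B` (`B` the tree two-cone bound `≤ e_∞`)
  refutes the rung.  Since `max(a,b) = (a+b)/2 + |a-b|/2` and `Σ_k A_k = Σ_r y_r Σ_j V(r_ij)` (`sum_load_eq`),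
  `U(y) = Σ_r y_r h_r + ¼ Σ_k |A_k - A_{conj k}|` with `h_r` the half pair-sum of row `r`: the dual objective is
  "average half-split energy + class-imbalance penalty";
* companion file `…RadiusLadderFarkasBalance`: the transport reading (class-balanced zoos force
  `(Σ y) · e_∞ ≤ Σ_r y_r h_r`), star forcing re-derived from this machinery, and the grouped certificate
  interface a kernel-checked certificate instantiates with tables.

So an exact rational Farkas vector `y` on the rows of a finite zoo, together with the finite list of bond groups,
their keys and loads, is a complete kernel-checkable refutation format for every rung — the multi-row,
multi-configuration generalisation of the star certificates of `…RadiusLadderStars`, and precisely the object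
RESULTS-R2 §6 P4/P6 say a refutation at `R ≥ 1.15` must be (a class-balanced weighting of over-bound rows).
The LP itself never enters: soundness is proved for the bound, not for any solver output (P1: an infeasible /
feasible LP verdict is evidence; only a checked `y` is a theorem).
-/

noncomputable section
namespace Summit.AtomisticToContinuum.Crystallization.Theorems.StrictSplittingRuleBirth

open scoped BigOperators Classical
open Literature.MathematicalPhysics.StatisticalMechanics

/-- Euclidean `3`-space. -/
local notation "E3" => EuclideanSpace ℝ (Fin 3)

/-! ## Keys and their two involutions -/

/-- A bond key: bond vector and joint pattern (the argument pair of a rule). [folklore] -/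
abbrev Key := EuclideanSpace ℝ (Fin 3) × Finset (EuclideanSpace ℝ (Fin 3))

namespace Key

/-- The key of the reversed bond: `(v, T) ↦ (-v, T - v)`. [folklore] -/
def conj (k : Key) : Key := (-k.1, k.2.image fun u => u - k.1)

/-- The inverted key: `(v, T) ↦ (-v, -T)`. [folklore] -/
def inv (k : Key) : Key := (-k.1, k.2.image fun u => -u)

/-- Reversing a bond twice gives it back. -/
theorem conj_conj (k : Key) : k.conj.conj = k := by
  obtain ⟨v, T⟩ := k
  simp only [conj, neg_neg, Finset.image_image]
  have h : ((fun u : E3 => u - -v) ∘ fun u : E3 => u - v) = id := by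
    funext u
    simp
  rw [h, Finset.image_id]

/-- Inverting a key twice gives it back. -/
theorem inv_inv (k : Key) : k.inv.inv = k := by
  obtain ⟨v, T⟩ := k
  simp only [inv, neg_neg, Finset.image_image]
  have h : ((fun u : E3 => -u) ∘ fun u : E3 => -u) = id := by
    funext u
    simp
  rw [h, Finset.image_id]

/-- The two involutions commute. -/
theorem conj_inv (k : Key) : k.inv.conj = k.conj.inv := by
  obtain ⟨v, T⟩ := k
  simp only [inv, conj, neg_neg, Finset.image_image]
  congr 1
  congr 1
  funext u
  simp only [Function.comp_apply]
  abel

/-- `conj` as a permutation of keys. [folklore] -/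
def conjPerm : Equiv.Perm Key := ⟨conj, conj, conj_conj, conj_conj⟩

/-- `inv` as a permutation of keys. [folklore] -/
def invPerm : Equiv.Perm Key := ⟨inv, inv, inv_inv, inv_inv⟩

end Key

/-- Membership in a `conj`-closed key set is `conj`-invariant. -/
theorem mem_iff_conj_mem {S : Finset Key} (hS : ∀ k ∈ S, k.conj ∈ S) (k : Key) : k ∈ S ↔ k.conj ∈ S :=
  ⟨hS k, fun h => by simpa [Key.conj_conj] using hS _ h⟩

/-- Membership in an `inv`-closed key set is `inv`-invariant. -/
theorem mem_iff_inv_mem {S : Finset Key} (hS : ∀ k ∈ S, k.inv ∈ S) (k : Key) : k ∈ S ↔ k.inv ∈ S :=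
  ⟨hS k, fun h => by simpa [Key.inv_inv] using hS _ h⟩

/-! ## Weighted zoos: rows, bond keys, class loads -/

section Zoo

variable {ι : Type*} [Fintype ι] {N : ι → ℕ}

/-- The bonds of a weighted zoo: pairs `(r, j)` with `j ≠ i r`. [folklore] -/
def bonds (i : ∀ r : ι, Fin (N r)) : Finset (Σ r : ι, Fin (N r)) :=
  Finset.univ.sigma fun r => Finset.univ.erase (i r)

/-- The key of the bond `(i r, j)` of row `r`, read at radius `R`. [folklore] -/
def bkey (R : ℝ) (x : ∀ r : ι, Fin (N r) → E3) (i : ∀ r : ι, Fin (N r)) (b : Σ r : ι, Fin (N r)) : Key :=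
  (x b.1 b.2 - x b.1 (i b.1), bondPattern R (x b.1) (i b.1) b.2)

/-- The coefficient of the bond `b` in the `y`-weighted sum of rows: `y_r · V(r_ij)`. [folklore] -/
def bcoef (x : ∀ r : ι, Fin (N r) → E3) (i : ∀ r : ι, Fin (N r)) (y : ι → ℝ) (b : Σ r : ι, Fin (N r)) : ℝ :=
  y b.1 * lennardJones (dist (x b.1 (i b.1)) (x b.1 b.2))

/-- The LOAD of the class `k`: `A_k = Σ_{bonds with key k} y_r · V(r_ij)`. [folklore] -/
def load (R : ℝ) (x : ∀ r : ι, Fin (N r) → E3) (i : ∀ r : ι, Fin (N r)) (y : ι → ℝ) (k : Key) : ℝ :=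
  ∑ b ∈ bonds i, if bkey R x i b = k then bcoef x i y b else 0

/-- **Regrouping by classes**: the `y`-weighted sum of the site rows of any rule is `Σ_k Φ(k) · A_k` over any key
set `S` containing the realised bond keys. -/
theorem weighted_siteE_eq (R : ℝ) (Φ : E3 → Finset E3 → ℝ) (x : ∀ r : ι, Fin (N r) → E3)
    (i : ∀ r : ι, Fin (N r)) (y : ι → ℝ) (S : Finset Key) (hkeys : ∀ b ∈ bonds i, bkey R x i b ∈ S) :
    ∑ r, y r * siteE R Φ (x r) (i r) = ∑ k ∈ S, Φ k.1 k.2 * load R x i y k := by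
  -- the weighted sum of rows as one sum over bonds
  have h1 : ∑ r, y r * siteE R Φ (x r) (i r) =
      ∑ b ∈ bonds i, Φ (bkey R x i b).1 (bkey R x i b).2 * bcoef x i y b := by
    unfold bonds
    rw [Finset.sum_sigma]
    refine Finset.sum_congr rfl fun r _ => ?_
    rw [perturbative_siteE_eq, Finset.mul_sum]
    refine Finset.sum_congr rfl fun j _ => ?_
    simp only [bkey, bcoef]
    ring
  -- each bond term as a sum over S picking its own key
  have h2 : ∀ b ∈ bonds i, Φ (bkey R x i b).1 (bkey R x i b).2 * bcoef x i y b =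
      ∑ k ∈ S, Φ k.1 k.2 * (if bkey R x i b = k then bcoef x i y b else 0) := by
    intro b hb
    have hmem := hkeys b hb
    have : ∀ k ∈ S, Φ k.1 k.2 * (if bkey R x i b = k then bcoef x i y b else 0) =
        if bkey R x i b = k then Φ k.1 k.2 * bcoef x i y b else 0 := by
      intro k _
      split_ifs <;> simp
    rw [Finset.sum_congr rfl this, Finset.sum_ite_eq]
    simp [hmem]
  rw [h1, Finset.sum_congr rfl h2, Finset.sum_comm]
  refine Finset.sum_congr rfl fun k _ => ?_
  rw [load, Finset.mul_sum]

/-- A convex combination with weight in `[0,1]` is at most the maximum. -/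
theorem convex_le_max {p a b : ℝ} (hp0 : 0 ≤ p) (hp1 : p ≤ 1) : p * a + (1 - p) * b ≤ max a b := by
  have h1 : p * a ≤ p * max a b := mul_le_mul_of_nonneg_left (le_max_left a b) hp0
  have h2 : (1 - p) * b ≤ (1 - p) * max a b := mul_le_mul_of_nonneg_left (le_max_right a b) (sub_nonneg.2 hp1)
  linarith

/-- **The Farkas bound, plain form.**  For every rule `Φ` and every `conj`-closed key set `S` of non-zero bond
vectors, `Σ_{k∈S} Φ(k) A_k ≤ ½ Σ_{k∈S} max(A_k, A_{conj k})` (attractive classes are charged `V·min(y⁺,y⁻)`,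
repulsive ones `V·max(y⁺,y⁻)`). -/
theorem sum_le_farkas {Φ : E3 → Finset E3 → ℝ} (hΦ : IsRule Φ) (A : Key → ℝ) (S : Finset Key)
    (hS : ∀ k ∈ S, k.conj ∈ S) (hS0 : ∀ k ∈ S, k.1 ≠ 0) :
    ∑ k ∈ S, Φ k.1 k.2 * A k ≤ (∑ k ∈ S, max (A k) (A k.conj)) / 2 := by
  have hre : ∑ k ∈ S, Φ k.conj.1 k.conj.2 * A k.conj = ∑ k ∈ S, Φ k.1 k.2 * A k :=
    Finset.sum_equiv Key.conjPerm (fun k => mem_iff_conj_mem hS k) (fun k _ => rfl)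
  have hle : ∑ k ∈ S, (Φ k.1 k.2 * A k + Φ k.conj.1 k.conj.2 * A k.conj) ≤
      ∑ k ∈ S, max (A k) (A k.conj) := by
    refine Finset.sum_le_sum fun k hk => ?_
    have hc : Φ k.1 k.2 + Φ k.conj.1 k.conj.2 = 1 := hΦ.2 k.1 k.2 (hS0 k hk)
    rw [show Φ k.conj.1 k.conj.2 = 1 - Φ k.1 k.2 by linarith]
    exact convex_le_max (hΦ.1 k.1 k.2).1 (hΦ.1 k.1 k.2).2
  rw [Finset.sum_add_distrib, hre] at hle
  linarith

/-- **The Farkas bound, inversion-averaged form.**  For every INVERSION-SYMMETRIC rule (`Φ(-v,-T) = Φ(v,T)`,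
free by `feasible_invAvg`) and every key set `S` of non-zero bond vectors closed under `conj` and `inv`,
`Σ_{k∈S} Φ(k) A_k ≤ ¼ Σ_{k∈S} max(A_k + A_{inv k}, A_{conj k} + A_{inv (conj k)})`. -/
theorem sum_le_farkas_inv {Φ : E3 → Finset E3 → ℝ} (hΦ : IsRule Φ)
    (hΦi : ∀ (v : E3) (T : Finset E3), Φ (-v) (T.image fun u => -u) = Φ v T) (A : Key → ℝ) (S : Finset Key)
    (hS : ∀ k ∈ S, k.conj ∈ S) (hSi : ∀ k ∈ S, k.inv ∈ S) (hS0 : ∀ k ∈ S, k.1 ≠ 0) :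
    ∑ k ∈ S, Φ k.1 k.2 * A k ≤
      (∑ k ∈ S, max (A k + A k.inv) (A k.conj + A k.conj.inv)) / 4 := by
  have hre1 : ∑ k ∈ S, Φ k.inv.1 k.inv.2 * A k.inv = ∑ k ∈ S, Φ k.1 k.2 * A k :=
    Finset.sum_equiv Key.invPerm (fun k => mem_iff_inv_mem hSi k) (fun k _ => rfl)
  have hre2 : ∑ k ∈ S, Φ k.conj.1 k.conj.2 * A k.conj = ∑ k ∈ S, Φ k.1 k.2 * A k :=
    Finset.sum_equiv Key.conjPerm (fun k => mem_iff_conj_mem hS k) (fun k _ => rfl)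
  have hre3 : ∑ k ∈ S, Φ k.conj.inv.1 k.conj.inv.2 * A k.conj.inv = ∑ k ∈ S, Φ k.1 k.2 * A k :=
    Finset.sum_equiv (Key.conjPerm.trans Key.invPerm)
      (fun k => (mem_iff_conj_mem hS k).trans (mem_iff_inv_mem hSi k.conj)) (fun k _ => rfl)
  have hle : ∑ k ∈ S, (Φ k.1 k.2 * A k + Φ k.inv.1 k.inv.2 * A k.inv +
      (Φ k.conj.1 k.conj.2 * A k.conj + Φ k.conj.inv.1 k.conj.inv.2 * A k.conj.inv)) ≤
      ∑ k ∈ S, max (A k + A k.inv) (A k.conj + A k.conj.inv) := by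
    refine Finset.sum_le_sum fun k hk => ?_
    have hc : Φ k.1 k.2 + Φ k.conj.1 k.conj.2 = 1 := hΦ.2 k.1 k.2 (hS0 k hk)
    have h1 : Φ k.inv.1 k.inv.2 = Φ k.1 k.2 := hΦi k.1 k.2
    have h2 : Φ k.conj.inv.1 k.conj.inv.2 = Φ k.conj.1 k.conj.2 := hΦi k.conj.1 k.conj.2
    rw [h1, h2, show Φ k.conj.1 k.conj.2 = 1 - Φ k.1 k.2 by linarith]
    have := convex_le_max (a := A k + A k.inv) (b := A k.conj + A k.conj.inv) (hΦ.1 k.1 k.2).1 (hΦ.1 k.1 k.2).2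
    linarith
  rw [Finset.sum_add_distrib, Finset.sum_add_distrib, Finset.sum_add_distrib, hre1, hre2, hre3] at hle
  linarith

/-! ## Weak duality -/

/-- **Weak duality with a threshold.**  If the rule `Φ` has every weighted row `≥ t` on the zoo, then for
non-negative weights `(Σ_r y_r) · t ≤ ½ Σ_{k∈S} max(A_k, A_{conj k})`. -/
theorem threshold_le_farkas {R t : ℝ} {Φ : E3 → Finset E3 → ℝ} (hΦ : IsRule Φ)
    (x : ∀ r : ι, Fin (N r) → E3) (i : ∀ r : ι, Fin (N r)) (ht : ∀ r, t ≤ siteE R Φ (x r) (i r))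
    {y : ι → ℝ} (hy : ∀ r, 0 ≤ y r) (S : Finset Key) (hS : ∀ k ∈ S, k.conj ∈ S)
    (hS0 : ∀ k ∈ S, k.1 ≠ 0) (hkeys : ∀ b ∈ bonds i, bkey R x i b ∈ S) :
    (∑ r, y r) * t ≤ (∑ k ∈ S, max (load R x i y k) (load R x i y k.conj)) / 2 := by
  have h1 : (∑ r, y r) * t ≤ ∑ r, y r * siteE R Φ (x r) (i r) := by
    rw [Finset.sum_mul]
    exact Finset.sum_le_sum fun r _ => mul_le_mul_of_nonneg_left (ht r) (hy r)
  rw [weighted_siteE_eq R Φ x i y S hkeys] at h1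
  exact h1.trans (sum_le_farkas hΦ _ S hS hS0)

/-- **Weak duality with a threshold, inversion-averaged form** (the rule must be inversion-symmetric). -/
theorem threshold_le_farkas_inv {R t : ℝ} {Φ : E3 → Finset E3 → ℝ} (hΦ : IsRule Φ)
    (hΦi : ∀ (v : E3) (T : Finset E3), Φ (-v) (T.image fun u => -u) = Φ v T)
    (x : ∀ r : ι, Fin (N r) → E3) (i : ∀ r : ι, Fin (N r)) (ht : ∀ r, t ≤ siteE R Φ (x r) (i r))
    {y : ι → ℝ} (hy : ∀ r, 0 ≤ y r) (S : Finset Key) (hS : ∀ k ∈ S, k.conj ∈ S)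
    (hSi : ∀ k ∈ S, k.inv ∈ S) (hS0 : ∀ k ∈ S, k.1 ≠ 0) (hkeys : ∀ b ∈ bonds i, bkey R x i b ∈ S) :
    (∑ r, y r) * t ≤ (∑ k ∈ S, max (load R x i y k + load R x i y k.inv)
      (load R x i y k.conj + load R x i y k.conj.inv)) / 4 := by
  have h1 : (∑ r, y r) * t ≤ ∑ r, y r * siteE R Φ (x r) (i r) := by
    rw [Finset.sum_mul]
    exact Finset.sum_le_sum fun r _ => mul_le_mul_of_nonneg_left (ht r) (hy r)
  rw [weighted_siteE_eq R Φ x i y S hkeys] at h1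
  exact h1.trans (sum_le_farkas_inv hΦ hΦi _ S hS hSi hS0)

/-- **Weak duality for a rung.**  If `RungAt δ R` holds then on every finite weighted zoo of `δ`-separated
configurations `(Σ_r y_r) · e_∞ ≤ ½ Σ_{k∈S} max(A_k, A_{conj k})`. -/
theorem eInf_le_farkas {δ R : ℝ} (hrung : RungAt δ R) (x : ∀ r : ι, Fin (N r) → E3)
    (hx : ∀ r, Sep δ (x r)) (i : ∀ r : ι, Fin (N r)) {y : ι → ℝ} (hy : ∀ r, 0 ≤ y r) (S : Finset Key)
    (hS : ∀ k ∈ S, k.conj ∈ S) (hS0 : ∀ k ∈ S, k.1 ≠ 0) (hkeys : ∀ b ∈ bonds i, bkey R x i b ∈ S) :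
    (∑ r, y r) * eInf ≤ (∑ k ∈ S, max (load R x i y k) (load R x i y k.conj)) / 2 := by
  obtain ⟨Φ, hr, hf⟩ := hrung
  exact threshold_le_farkas hr x i (fun r => hf (N r) (x r) (hx r) (i r)) hy S hS hS0 hkeys

/-- **Weak duality for a rung, inversion-averaged form** (inversion averaging is free: `feasible_invAvg`). -/
theorem eInf_le_farkas_inv {δ R : ℝ} (hrung : RungAt δ R) (x : ∀ r : ι, Fin (N r) → E3)
    (hx : ∀ r, Sep δ (x r)) (i : ∀ r : ι, Fin (N r)) {y : ι → ℝ} (hy : ∀ r, 0 ≤ y r) (S : Finset Key)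
    (hS : ∀ k ∈ S, k.conj ∈ S) (hSi : ∀ k ∈ S, k.inv ∈ S) (hS0 : ∀ k ∈ S, k.1 ≠ 0)
    (hkeys : ∀ b ∈ bonds i, bkey R x i b ∈ S) :
    (∑ r, y r) * eInf ≤ (∑ k ∈ S, max (load R x i y k + load R x i y k.inv)
      (load R x i y k.conj + load R x i y k.conj.inv)) / 4 := by
  obtain ⟨Φ, hr, hf⟩ := hrung
  exact threshold_le_farkas_inv (isRule_invAvg hr) (fun v T => invAvg_neg Φ v T) x i
    (fun r => feasible_invAvg hf (N r) (x r) (hx r) (i r)) hy S hS hSi hS0 hkeys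

/-! ## Certificates: a Farkas vector beating the tree bound `B ≤ e_∞` refutes the rung -/

/-- **LP refutation certificate, plain form**: `½ Σ max(A_k, A_{conj k}) < (Σ y) · B` refutes `RungAt δ R`. -/
theorem not_rungAt_of_farkas {δ R : ℝ} (x : ∀ r : ι, Fin (N r) → E3) (hx : ∀ r, Sep δ (x r))
    (i : ∀ r : ι, Fin (N r)) {y : ι → ℝ} (hy : ∀ r, 0 ≤ y r) (S : Finset Key)
    (hS : ∀ k ∈ S, k.conj ∈ S) (hS0 : ∀ k ∈ S, k.1 ≠ 0) (hkeys : ∀ b ∈ bonds i, bkey R x i b ∈ S)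
    (hcert : (∑ k ∈ S, max (load R x i y k) (load R x i y k.conj)) / 2 < (∑ r, y r) * twoConeB) :
    ¬ RungAt δ R := fun hrung => by
  have h := eInf_le_farkas hrung x hx i hy S hS hS0 hkeys
  have hB : (∑ r, y r) * twoConeB ≤ (∑ r, y r) * eInf :=
    mul_le_mul_of_nonneg_left twoConeB_le_eInf (Finset.sum_nonneg fun r _ => hy r)
  linarith

/-- **LP refutation certificate, inversion-averaged form.** -/
theorem not_rungAt_of_farkas_inv {δ R : ℝ} (x : ∀ r : ι, Fin (N r) → E3) (hx : ∀ r, Sep δ (x r))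
    (i : ∀ r : ι, Fin (N r)) {y : ι → ℝ} (hy : ∀ r, 0 ≤ y r) (S : Finset Key)
    (hS : ∀ k ∈ S, k.conj ∈ S) (hSi : ∀ k ∈ S, k.inv ∈ S) (hS0 : ∀ k ∈ S, k.1 ≠ 0)
    (hkeys : ∀ b ∈ bonds i, bkey R x i b ∈ S)
    (hcert : (∑ k ∈ S, max (load R x i y k + load R x i y k.inv)
      (load R x i y k.conj + load R x i y k.conj.inv)) / 4 < (∑ r, y r) * twoConeB) :
    ¬ RungAt δ R := fun hrung => by
  have h := eInf_le_farkas_inv hrung x hx i hy S hS hSi hS0 hkeys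
  have hB : (∑ r, y r) * twoConeB ≤ (∑ r, y r) * eInf :=
    mul_le_mul_of_nonneg_left twoConeB_le_eInf (Finset.sum_nonneg fun r _ => hy r)
  linarith

/-! ## Total load -/

/-- The total load is the weighted double pair-sum: `Σ_{k∈S} A_k = Σ_r y_r Σ_{j≠i_r} V(r_ij)`. -/
theorem sum_load_eq (R : ℝ) (x : ∀ r : ι, Fin (N r) → E3) (i : ∀ r : ι, Fin (N r)) (y : ι → ℝ)
    (S : Finset Key) (hkeys : ∀ b ∈ bonds i, bkey R x i b ∈ S) :
    ∑ k ∈ S, load R x i y k =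
      ∑ r, y r * ∑ j ∈ Finset.univ.erase (i r), lennardJones (dist (x r (i r)) (x r j)) := by
  have h := weighted_siteE_eq R (fun _ _ => (1 : ℝ)) x i y S hkeys
  simp only [one_mul] at h
  rw [← h]
  refine Finset.sum_congr rfl fun r _ => ?_
  rw [perturbative_siteE_eq]
  simp only [one_mul]

end Zoo

end Summit.AtomisticToContinuum.Crystallization.Theorems.StrictSplittingRuleBirth

end
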